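import Literature.NumberTheory.LFunctions.DedekindZetaClassSumCont
import Literature.NumberTheory.LFunctions.PrimeIdealTheorem
import HarnessLib

/-!
# Thorner–Zaman (2019), Theorem 1.4, for ideal classes of imaginary quadratic fields: a uniform
# prime ideal theorem in ideal classes with the Landau–Siegel term, for `x ≥ (4|d_K|)^{c₁}`

Topic `Literature/NumberTheory/LFunctions`; namespace `Literature.NumberTheory.LFunctions.NumberField`
(next to `primeIdealCount`, `classSumCont`), paper-specific items grouped under `ThornerZaman`.
This file VENDORS one NAMED FACT (`def ThornerZaman2019_classPNT_imaginaryQuadratic : Prop`, not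
proved here) and the definitions needed to type it; the API lemmas (`classGroupLFunction_eq_tsum`:
the Dirichlet series on `Re s > 1`; `classGroupLFunction_one`: `L(s, 1) = ζ_K(s)`; counting
lemmas) are proved.

## Source, as printed

J. Thorner, A. Zaman, *A unified and improved Chebotarev density theorem*, Algebra & Number
Theory 13 (2019) 1039–1068 [ThornerZaman2019] (read: arXiv:1803.02823v·, §1.1–1.2 and §3).
Notation (§1): `L/F` Galois with group `G`, `C ⊆ G` a conjugacy class,
`π_C(x) = #{N_{F/ℚ} 𝔭 ≤ x : 𝔭 unramified in L, [L/F, 𝔭] = C}`, `Li(x) = ∫₂ˣ dt/log t`;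
`H ⊆ G` abelian with `C ∩ H ≠ ∅`, `K = L^H`, the characters `χ ∈ Ĥ` are Hecke characters of `K`
with conductors `𝔣_χ`, `𝒬 = max_χ N_{K/ℚ} 𝔣_χ` ((1.9)); "from work of Stark, at most one real
Hecke character `χ₁ ∈ Ĥ` has an associated Hecke `L`-function `L(s, χ₁, L/K)` with a Landau–Siegel
zero `β₁ = 1 − λ₁ / log(D_K 𝒬 n_K^{n_K})`, where `0 < λ₁ < 1/8`."

> **Theorem 1.4.** Let `L/F` be a Galois extension of number fields with Galois group `G`, and let
> `C ⊆ G` be a conjugacy class. Let `H ⊆ G` be an abelian subgroup such that `C ∩ H` is nonempty,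
> let `K` be the fixed field of `H`, and choose `g_C ∈ C ∩ H`. If `x ≥ (D_K 𝒬 n_K^{n_K})^{c₁}`, then
> `π_C(x) = (|C|/|G|) (Li(x) − θ₁ Li(x^{β₁})) (1 + O(exp[−c₂ log x / log(D_K 𝒬 n_K^{n_K})] + exp[−(c₂ log x)^{1/2} / n_K^{1/2}]))`,
> where `θ₁ = χ₁(g_C)` if `β₁` exists and `θ₁ = 0` otherwise and `𝒬` is given by (1.9). The
> constants `c₁` and `c₂` are the same as in Theorem 1.1

("absolute and effective constants `c₁ > 0` and `c₂ > 0`", Theorem 1.1; the `O`-constant is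
absolute).

## The specialisation vendored here (requested by route QuantumAdvantage/DarkClassGroups)

`F = K` an imaginary quadratic field, `L = H_K` its Hilbert class field, `G = H = Gal(H_K/K)`,
which class field theory identifies with the class group `Cl(K)` through the Artin map
`𝔭 ↦ [𝔭]` (every prime of `K` is unramified in `H_K`; the characters of `G` are the class group
characters, Hecke characters of conductor `(1)`, so `𝒬 = 1`); `n_K = 2`, `D_K = |d_K|`, hence
`D_K 𝒬 n_K^{n_K} = 4|d_K|` (`ThornerZaman.condQ`), and `L(s, χ, L/K) = ∑_𝔞 χ([𝔞]) N𝔞^{-s}`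
(`classGroupLFunction`, typed through the tree's continued class partial zeta functions
`classSumCont`, Neukirch VII (5.9)–(5.11)).  For a class `C ∈ Cl(K)`:
`π_C(x) = #{𝔭 : N𝔭 ≤ x, [𝔭] = C}` (`primeIdealClassCount`), and for `x ≥ (4|d_K|)^{c₁}`

`π_C(x) = h_K⁻¹ (Li(x) − θ₁ Li(x^{β₁})) (1 + E)`, `|E| ≤ c₃ (exp(−c₂ log x / log(4|d_K|)) + exp(−(c₂ log x / 2)^{1/2}))`

(`ThornerZaman.errorTerm`), with `θ₁ = χ₁(C) ∈ {±1}` if some real class group character `χ₁`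
(`χ₁² = 1`) has a real zero `β₁ ∈ (1 − 1/(8 log(4|d_K|)), 1)` of `L(s, χ₁)`, and `θ₁ = 0` (no
`Li(x^{β₁})` term) if no real class group character has such a zero.  The Lean statement records
exactly this dichotomy, with `(χ₁, β₁)` quantified existentially in the second case and the same
pair serving all classes `C` and all `x`; the paper's assertion (after Stark 1974) that such a pair
is unique, and that `β₁` is simple, is not restated (the statement is implied by the printed one
either way).

Design notes. (1) `K : Type` inside the `Prop` (every number field has a model in `Type`), as in
`Literature.NumberTheory.LFunctions.NumberField.landau_prime_ideal_theorem`. (2) The real characters are the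
`χ : Cl(K) →* ℂˣ` with `χ * χ = 1`; their values are `±1` and enter as `(χ C : ℂ).re`. (3) `Li` is
the tree's `offsetLogIntegral`, `x^{β₁}` is `Real.rpow`, `h_K` is Mathlib's
`NumberField.classNumber`, "imaginary quadratic" is `finrank ℚ K = 2 ∧ IsTotallyComplex K` as in
the route's statements. (4) NOT here: the general Theorem 1.4 / 1.1 (arbitrary `L/F`, `H`, `𝒬`),
Remark 1.5, Corollaries 1.2–1.3, the application Theorem 1.6, and the corollary for subgroups of
`Cl(K)` consumed by the route (a consequence by orthogonality of characters, left to its prover).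

## References

* J. Thorner, A. Zaman, *A unified and improved Chebotarev density theorem*, Algebra Number
  Theory 13 (2019), no. 5, 1039–1068, Thm. 1.4 (with Thm. 1.1 for the constants, §3 Thm. 3.1 and
  Thm. 3.3 for the exceptional zero); arXiv:1803.02823. [ThornerZaman2019]
* H. M. Stark, *Some effective cases of the Brauer–Siegel theorem*, Invent. Math. 23 (1974)
  135–152 (at most one exceptional real character). [Stark1974]
* J. C. Lagarias, A. M. Odlyzko, *Effective versions of the Chebotarev density theorem* (1977),
  Thm. 1.3 (the shape being refined). [LagariasOdlyzko1977]
* J. Neukirch, *Algebraic Number Theory* (1999), Ch. VI §6 (Hilbert class field, Artin map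
  `Cl(K) ≅ Gal(H_K/K)`), Ch. VII (5.9)–(5.11) (class partial zeta functions). [NeukirchANT1999]
-/

noncomputable section

open scoped NumberField nonZeroDivisors
open Complex

namespace Literature.NumberTheory.LFunctions.NumberField

variable (K : Type*) [Field K] [NumberField K]

/-! ### Primes in an ideal class; `L`-functions of class group characters -/

/-- The set of prime ideals `𝔭` of `𝓞 K` with `N𝔭 ≤ x` lying in the ideal class `C ∈ Cl(K)`
(`ClassGroup.mk0`; such `𝔭` are nonzero).  For the Hilbert class field `H_K/K` and the Artin
isomorphism `Cl(K) ≅ Gal(H_K/K)` this is the set counted by Thorner–Zaman's `π_C(x, H_K/K)`.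
[cite: ThornerZaman2019, §1.1 (1.1)] -/
def primeIdealsInClassLE (C : ClassGroup (𝓞 K)) (x : ℝ) : Set (Ideal (𝓞 K)) :=
  {P | P.IsPrime ∧ (Ideal.absNorm P : ℝ) ≤ x ∧ ∃ hP : P ∈ (Ideal (𝓞 K))⁰, ClassGroup.mk0 ⟨P, hP⟩ = C}

/-- **`π_C(x) = #{𝔭 : N𝔭 ≤ x, [𝔭] = C}`**, the number of prime ideals of norm at most `x` in the
ideal class `C`. [cite: ThornerZaman2019, §1.1 (1.1)] -/
def primeIdealClassCount (C : ClassGroup (𝓞 K)) (x : ℝ) : ℕ :=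
  (primeIdealsInClassLE K C x).ncard

variable {K} in
/-- Primes in a class are among the nonzero primes of norm `≤ x` (`primeIdealsLE`). [folklore] -/
theorem primeIdealsInClassLE_subset (C : ClassGroup (𝓞 K)) (x : ℝ) :
    primeIdealsInClassLE K C x ⊆ primeIdealsLE K x := by
  rintro P ⟨hP, hx, h0, -⟩
  exact ⟨hP, nonZeroDivisors.ne_zero h0, hx⟩

variable {K} in
/-- There are finitely many primes of norm `≤ x` in a class. [folklore] -/
theorem finite_primeIdealsInClassLE (C : ClassGroup (𝓞 K)) (x : ℝ) :
    (primeIdealsInClassLE K C x).Finite :=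
  (finite_primeIdealsLE K x).subset (primeIdealsInClassLE_subset C x)

variable {K} in
/-- `π_C(x) ≤ π_K(x)`. [folklore] -/
theorem primeIdealClassCount_le_primeIdealCount (C : ClassGroup (𝓞 K)) (x : ℝ) :
    primeIdealClassCount K C x ≤ primeIdealCount K x :=
  Set.ncard_le_ncard (primeIdealsInClassLE_subset C x) (finite_primeIdealsLE K x)

/-- **The `L`-function of a class group character** `χ : Cl(K) → ℂˣ` (a Hecke character of
conductor `(1)`), as a function on all of `ℂ` (holomorphic off `s = 1`; classically entire for `χ ≠ 1`, not proved here):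
`L(s, χ) = ∑_{C ∈ Cl(K)} χ(C) ζ(C, s)` with the tree's continued class partial zeta functions
`ζ(C, s) = classSumCont` (`= ∑_{𝔟 ∈ C} N𝔟^{-s}` for `Re s > 1`, `classSumCont_eq_tsum`), so that
`L(s, χ) = ∑_{𝔞 ≠ 0} χ([𝔞]) N𝔞^{-s}` for `Re s > 1`; for `χ = 1` it is `ζ_K`
(`classGroupLFunction_one`).  This is Thorner–Zaman's `L(s, χ, H_K/K)`.
[cite: NeukirchANT1999, Ch. VII (5.9)–(5.11)] -/
def classGroupLFunction (χ : ClassGroup (𝓞 K) →* ℂˣ) (s : ℂ) : ℂ :=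
  ∑ C : ClassGroup (𝓞 K), (χ C : ℂ) * classSumCont (thetaIdeal_inv_holds K) C s

/-- For the trivial character, `L(s, 1) = ζ_K(s)` (the tree's continuation `dedekindZetaCont`)
for every `s ≠ 1` (`dedekindZetaCont_eq_sum_classSumCont`, Neukirch VII (5.11) (i)).
[cite: NeukirchANT1999, Ch. VII (5.11)] -/
theorem classGroupLFunction_one {s : ℂ} (hs : s ≠ 1) :
    classGroupLFunction K 1 s = dedekindZetaCont K s := by
  rw [dedekindZetaCont_eq_sum_classSumCont (thetaIdeal_inv_holds K) hs, classGroupLFunction]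
  exact Finset.sum_congr rfl fun C _ ↦ by simp

variable {K} in
/-- Values of a class group character have absolute value `1` (roots of unity of order dividing
`h_K`). [folklore] -/
theorem norm_classGroupChar_apply (χ : ClassGroup (𝓞 K) →* ℂˣ) (C : ClassGroup (𝓞 K)) :
    ‖(χ C : ℂ)‖ = 1 := by
  refine Complex.norm_eq_one_of_pow_eq_one (n := Fintype.card (ClassGroup (𝓞 K))) ?_
    Fintype.card_ne_zero
  rw [← Units.val_pow_eq_pow_val, ← map_pow, pow_card_eq_one, map_one, Units.val_one]

/-- **`L(s, χ) = ∑_{𝔞 ≠ 0} χ([𝔞]) N𝔞^{-s}` for `Re s > 1`**: on the half-plane of absolute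
convergence `classGroupLFunction` is the Dirichlet series of the class group character (split along
the classes, `classSumCont_eq_tsum`, and reassembled fibrewise as in
`dedekindZeta_eq_sum_classSum`; Neukirch VII §5, after (5.2), and VII (8.2) for `𝔪 = 1`).
[cite: NeukirchANT1999, Ch. VII (5.9)–(5.11)] -/
theorem classGroupLFunction_eq_tsum (χ : ClassGroup (𝓞 K) →* ℂˣ) {s : ℂ} (hs : 1 < s.re) :
    classGroupLFunction K χ s =
      ∑' I : (Ideal (𝓞 K))⁰,
        (χ (ClassGroup.mk0 I) : ℂ) * ((Ideal.absNorm (I : Ideal (𝓞 K)) : ℕ) : ℂ) ^ (-s) := by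
  classical
  set f : (Ideal (𝓞 K))⁰ → ℂ := fun I ↦
    (χ (ClassGroup.mk0 I) : ℂ) * ((Ideal.absNorm (I : Ideal (𝓞 K)) : ℕ) : ℂ) ^ (-s) with hf
  have h2 : Summable fun I : (Ideal (𝓞 K))⁰ ↦ ((Ideal.absNorm (I : Ideal (𝓞 K)) : ℕ) : ℂ) ^ (-s) :=
    (Literature.NumberTheory.LFunctions.hasSum_absNorm_cpow K hs).summable.comp_injective
      Subtype.val_injective
  have hsum : Summable f := by
    refine Summable.of_norm_bounded h2.norm fun I ↦ ?_
    rw [hf, norm_mul, norm_classGroupChar_apply, one_mul]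
  have h3 := hsum.hasSum.tsum_fiberwise fun I : (Ideal (𝓞 K))⁰ ↦ ClassGroup.mk0 I
  rw [← h3.tsum_eq, tsum_fintype, classGroupLFunction]
  refine Finset.sum_congr rfl fun C _ ↦ ?_
  rw [classSumCont_eq_tsum _ C hs, ← tsum_mul_left]
  exact tsum_congr fun I ↦ by simp only [hf, show ClassGroup.mk0 I.1 = C from I.2]

namespace ThornerZaman

/-- Thorner–Zaman's `D_K 𝒬 n_K^{n_K}` for an imaginary quadratic field and its Hilbert class
field: `𝒬 = 1` (class group characters have conductor `(1)`), `n_K = 2`, so it is `4 |d_K|`.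
[cite: ThornerZaman2019, Thm. 1.4] -/
def condQ : ℝ :=
  4 * |(NumberField.discr K : ℝ)|

/-- `4|d_K| ≥ 4 > 1`, so `log(4|d_K|) > 0` (`|d_K| ≥ 1`, Mathlib `NumberField.discr_ne_zero`).
[folklore] -/
theorem one_lt_condQ : 1 < condQ K := by
  have h : (1 : ℝ) ≤ |(NumberField.discr K : ℝ)| := by
    have h0 : (NumberField.discr K : ℝ) ≠ 0 := by exact_mod_cast NumberField.discr_ne_zero K
    have h1 : (1 : ℝ) ≤ |((NumberField.discr K : ℤ) : ℝ)| := by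
      rw [← Int.cast_abs]
      exact_mod_cast Int.one_le_abs (NumberField.discr_ne_zero K)
    exact h1
  unfold condQ
  linarith

/-- The error term of Theorem 1.4 for `n_K = 2` and `D_K 𝒬 n_K^{n_K} = Q`:
`exp(−c₂ log x / log Q) + exp(−(c₂ log x)^{1/2} / 2^{1/2})`. [cite: ThornerZaman2019, Thm. 1.4] -/
def errorTerm (c₂ Q x : ℝ) : ℝ :=
  Real.exp (-(c₂ * Real.log x / Real.log Q)) + Real.exp (-Real.sqrt (c₂ * Real.log x / 2))

/-- The error term is positive. [folklore] -/
theorem errorTerm_pos (c₂ Q x : ℝ) : 0 < errorTerm c₂ Q x :=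
  add_pos (Real.exp_pos _) (Real.exp_pos _)

end ThornerZaman

/-! ### The named fact -/

/-- **Thorner–Zaman (2019), Theorem 1.4, for the ideal classes of imaginary quadratic fields**
(`F = K` imaginary quadratic, `L = H_K` the Hilbert class field, `H = G = Gal(H_K/K) ≅ Cl(K)` by the
Artin map `𝔭 ↦ [𝔭]`, `n_K = 2`, `D_K = |d_K|`, `𝒬 = 1`).  There are absolute constants
`c₁, c₂, c₃ > 0` such that for every imaginary quadratic field `K`, with `Q = 4|d_K|`,
`h = h_K`, `Li(x) = ∫₂ˣ dt/log t` and `E(x) = c₃ (exp(−c₂ log x / log Q) + exp(−(c₂ log x / 2)^{1/2}))`: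
EITHER no real class group character `χ` (`χ² = 1`) has a real zero of `L(s, χ)` in
`1 − 1/(8 log Q) < s < 1`, and then for every class `C ∈ Cl(K)` and every `x ≥ Q^{c₁}`
`|π_C(x) − Li(x)/h| ≤ E(x) · Li(x)/h`;
OR there are a real class group character `χ₁` and a real zero `β₁ ∈ (1 − 1/(8 log Q), 1)` of
`L(s, χ₁)` such that for every class `C` and every `x ≥ Q^{c₁}`
`|π_C(x) − (Li(x) − χ₁(C) Li(x^{β₁}))/h| ≤ E(x) · (Li(x) − χ₁(C) Li(x^{β₁}))/h`.
This is the printed `π_C(x) = (|C|/|G|)(Li(x) − θ₁ Li(x^{β₁}))(1 + O(…))`, `θ₁ = χ₁(g_C)` if `β₁`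
exists and `θ₁ = 0` otherwise, with `|C| = 1`, `|G| = h_K`; the paper's uniqueness of `(χ₁, β₁)`
(Stark 1974) is not restated. [cite: ThornerZaman2019, Thm. 1.4] -/
def ThornerZaman2019_classPNT_imaginaryQuadratic : Prop :=
  ∃ c₁ c₂ c₃ : ℝ, 0 < c₁ ∧ 0 < c₂ ∧ 0 < c₃ ∧
    ∀ (K : Type) [Field K] [NumberField K], Module.finrank ℚ K = 2 → NumberField.IsTotallyComplex K →
      (((∀ χ : ClassGroup (𝓞 K) →* ℂˣ, χ * χ = 1 →
            ∀ β : ℝ, 1 - 1 / (8 * Real.log (ThornerZaman.condQ K)) < β → β < 1 →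
              classGroupLFunction K χ β ≠ 0) ∧
          ∀ (C : ClassGroup (𝓞 K)) (x : ℝ), ThornerZaman.condQ K ^ c₁ ≤ x →
            |(primeIdealClassCount K C x : ℝ) - offsetLogIntegral x / NumberField.classNumber K| ≤
              c₃ * ThornerZaman.errorTerm c₂ (ThornerZaman.condQ K) x *
                (offsetLogIntegral x / NumberField.classNumber K)) ∨
        ∃ (χ₁ : ClassGroup (𝓞 K) →* ℂˣ) (β₁ : ℝ), χ₁ * χ₁ = 1 ∧
          1 - 1 / (8 * Real.log (ThornerZaman.condQ K)) < β₁ ∧ β₁ < 1 ∧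
          classGroupLFunction K χ₁ β₁ = 0 ∧
          ∀ (C : ClassGroup (𝓞 K)) (x : ℝ), ThornerZaman.condQ K ^ c₁ ≤ x →
            |(primeIdealClassCount K C x : ℝ) -
                (offsetLogIntegral x - ((χ₁ C : ℂ)).re * offsetLogIntegral (x ^ β₁)) /
                  NumberField.classNumber K| ≤
              c₃ * ThornerZaman.errorTerm c₂ (ThornerZaman.condQ K) x *
                ((offsetLogIntegral x - ((χ₁ C : ℂ)).re * offsetLogIntegral (x ^ β₁)) /
                  NumberField.classNumber K))

end Literature.NumberTheory.LFunctions.NumberField
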